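import Summits.QuantumFields.BalabanUV.Beta.FP.TorusCompositeObjectsG
import Summits.QuantumFields.BalabanUV.Beta.FP.OneShotSocketUnit
import Literature.MathematicalPhysics.QuantumFieldTheory.Balaban1983to89.Beta.HessKerRate

/-!
# `BalabanUV.Beta.FP.NestedConstraintScaling` — row D1 ∕ (C1), PART 35: **WHERE `∏ stepScale` LIVES IN THE NESTED ONE-SHOT SYSTEM**
# (the row's kernel answer to road «FP» Q-FP-47-2, journal l.68134 ∕ l.68161; Engine C K2L-C gate G3: `c* = 3⁵ = stepScale 3 3 1` at n = 0)

WHAT (all [folklore] bookkeeping over the cell's OWN objects; 0 `def`, nothing of Bałaban's asserted).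
* §1 `bhKStepSh_inr_inl ∕ _inl_inr`: the BORDER of an1's shifted straight spread `𝕄_ℓ = bhKStepSh d Lc D ℓ = bhKStep ℓ + stepScale ℓ • D` at level `ℓ`
  is `stepScale d Lc ℓ` times its border at level `0` (`bhKStep_succ_inr_inl`: «one unit `M^{d+2}` per field slot»; `stepScale 0 = 1`) — for ANY shift `D`,
  right side in the `bhKStepSh … 0` letter §2 rewrites with (content twins at `D := Dsh`: `E3ContactFactor.bhKStepSh_mf`,
  `FP/TorusSymGaugeCovariance.bhKStepSh_Dsh_inr_inl_eq_smul`, right side `stepScale · (bhK + Dsh)`).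
* §2 **`QstepSym_eq_smul`**: the (0.4)-symmetrised one-step rows of the torus tower (`FP/TorusCompositeObjectsG.QstepSym Lc M ℓ`, the `hQ₁₀`∕`hQ₂₀`
  letter of the (III′) call and of the END wrappers v5…v8) satisfy `QstepSym Lc M ℓ = stepScale d Lc ℓ • QstepSym Lc M 0` — level enters ONLY as a scalar.
* §3 **`compRowsSym_eq_prod_smul`**: the `n`-fold composite `compRowsSym Lc M lev rs n = (∏ i ∈ range n, stepScale d Lc (lev (i+1))) • compRowsSym Lc M 0 rs n`
  (`compRowsG` is a plain matrix product; induction on the depth).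
* §4 **`nestedConstraint_eq_prod_smul`**: the END wrapper's nested coarse constraint `𝔔₀ = Q₂₀ * Q₁₀` (`hQ₂₀ : Q₂₀ = QstepSym Lc (Mc B) (n+1)`,
  `hQ₁₀ : Q₁₀ = compRowsSym Lc (fine Lc (Mc B)) (fun i => n+1-i) _ (n+1)`, `h𝔔₀`) IS `s_n • 𝔔ᵘ` with
  **`s_n = ∏ ℓ ∈ range (n+1+1), stepScale d Lc ℓ`** (`= Lc^{(d+2)(n+1)(n+2)/2}`; at `d = 3`, `Lc = 3`, `n = 0`: `3⁵ = 243` — Engine C's `c*` to twelve digits)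
  and `𝔔ᵘ = QstepSym Lc M 0 * compRowsSym Lc (fine Lc M) 0 rs (n+1)` the UNIT-border composite (every storey's rows at level-`0` scale); also the wrapper's own
  product shape `stepScale (n+1) * ∏ i ∈ range (n+1), stepScale (n+1-(i+1))`.
* §5 THE KKT CONSTRAINT-SCALING LEMMA IS ALREADY IN THE TREE — `FP/OneShotSocketUnit` (leaf-02 g27, the (S3-1) sockets' row unit; index convention
  `ν ⊕ (κ ⊕ ρ)` = field ⊕ (coarse rows ⊕ comb rows)), CITED BY NAME, not restated: (U6) `OneShotSocketUnit.kkt_fromRows_smul`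
  `kkt H (fromRows (c • Q) P) = diagonal w * kkt H (fromRows Q P) * diagonal w`, `w = Sum.elim 1 (Sum.elim c 1)`; `OneShotSocketUnit.diagonal_rowUnit_mul_inv`;
  (U7) `OneShotSocketUnit.kkt_fromRows_mul_rightInverse_of_smul`: a right inverse `X` of the SCALED system `kkt H [c • Q; P]` (the END wrapper's `hXN` shape, `𝔔₀ = s_n • 𝔔ᵘ`
  by §4) gives the right inverse `diagonal w * X * diagonal w` of the UNIT-border system; (U8) `OneShotSocketUnit.submatrix_leg_rowUnit`.  Added here, over them:
  **`kkt_fromRows_smul_mul_conj_eq_one`** (the converse transfer UNIT ⟶ SCALED with `w⁻¹ = Sum.elim 1 (Sum.elim c⁻¹ 1)`) and **`submatrix_conj_fieldCoarse`**: on the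
  (field ⊕ coarse) slots — the block the END's (S3-1) N leg `hLN` displays — `diagonal w * X * diagonal w` reads `fromBlocks X_ff (c • X_fc) (c • X_cf) ((c*c) • X_cc)`.
* §6 **`hessKer_scaleK_chart`**: `hessKer (σAσ) V W = hessKer A (σVσ) (σWσ)` for any fibre scaling `σ` with a two-sided inverse (`HessKerRate.hessKer_scaleK`
  read from the chart's side): conjugating the CHART by `σ` is the same as conjugating BOTH vertex families by `σ`.

THE ROW's ANSWER TO Q-FP-47-2 (zero weight; the repair letter is the road's).  The one-shot KKT inverse `XN = (kkt H₀ [𝔔₀; P])⁻¹` of the wrapper is, by §4–§5,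
the `D_{s_n}⁻¹`-conjugate of the inverse `Xᵘ` of the UNIT-border nested system `kkt H₀ [𝔔ᵘ; P]` (same `H₀`, same gauge rows `P`; (U7)): field–field block equal,
field–coarse blocks `× s_n⁻¹`, coarse–coarse block `× s_n⁻²` (§5 `submatrix_conj_fieldCoarse`).  The composite chart `AN (Roots.ctr Lc) (n+1) = compChart … =
Ψ̂ ∘ coDressKBmAt (KInv (Lc^(n+2))) ∘ Ψ̂ᵀ` answers UNIT prescribed averages BY CONSTRUCTION (`OneStepResolventKernel.KInv`: «`(inl κ, inr l) ↦ ℋ`: prescribed block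
average → field»; the corrector and the block-mean dressing are scale-free conjugations) — so the (L2′) identification is between `Xᵘ` and `AN`, and the displayed
leg `hLN` at `A := AN` is the UNIT leg placed on the SCALED system: the scalar belongs to THE LEG, as the fibre scaling `σ_n (inl) = 1`, `σ_n (inr) = s_n⁻¹` of
`AN`'s blocks (the road's `A_N := D·AN·D`), with `s_n = ∏_{ℓ < n+2} stepScale 3 Lc ℓ` — NOT to `𝔔₀` (the (III′) literal's `hQ₁₀`∕`hQ₂₀` rows, FREEZE (0); every
𝔔-side letter, direction prefactor and lock of v5…v8 was located under it) and NOT to `AN` (the (C1) record `TshotOf_JcComp_succ_succ` reads `hessKer AN VN WN`).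
CONSEQUENCE FOR THE END (§6, said plainly): with the σ-leg the law delivers `hessKer (σ_n AN σ_n) V′ W′` at the N-system's vertex read-outs `V′, W′` (H-side rows
`ff`, 𝔔-side rows = variations of the SCALED constraint), `= hessKer AN (σ_n V′ σ_n) (σ_n W′ σ_n)`: the END keeps the chart `AN` iff the record's vertex families at
the `hN` junction are the σ_n-conjugates of the N-side read-outs — border (field–multiplier) entries divided by `s_n`, i.e. the composite record read at UNIT
border pins (the displayed locks `hcVH`∕`hcB` carry `∏ stepScale` because they were located against the scaled 𝔔-rows; for the RECORD `JcComp … P` at the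
`hN` junction the border pins are those divided by `s_n`).  Which display v9 chooses (σ in `hLN` + unit record pins, or a unit `𝔔ᵘ` throughout) is the road's;
§4–§6 are the three identities either choice rests on.  At n = 0 this is Engine C's located `3⁵` exactly; at n ≥ 1 the value `s_n` is this file's structural
statement (§4), not a measurement.

HONEST FRAMING.  [folklore] re-indexing ∕ `Matrix` algebra BY NAME over the cell's own objects (`bhKStepSh`, `QstepSym`, `compRowsSym`, `kkt`, `scaleK`;
§5's scaling lemma is `FP/OneShotSocketUnit` U6–U8 BY NAME — v1.1: v1's field-generic restatement of U6∕U7 removed on the chair's INFO-3);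
no `def`, no `instance`, no `notation`, no `axiom`, nothing cited as a hypothesis; nothing of Bałaban's asserted, valued or discharged; 0 estimates;
0∕4 row-D1 binders (hW ∕ hR ∕ D1Tel ∕ D1Rep); ROOT M‴ p325680 ∕ P5c ∕ D6 untouched; (L2′) NOT discharged (this file says WHERE its one scalar sits, not
that the leg holds); NOT (C1) complete, NOT (T-ID), NOT D1, NEVER «G-an2-4 closed», NOT BetaPertH, NOT continuum, NOT Clay.
HONEST DEPENDENCY (page 1, mandatory): continuum YM on T⁴ ⇐ BetaPertH ∧ nine spine estimates (0/9 proved); BetaPertH ⇐ (D1) ∧ (D4) ∧ CAP+tail;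
G-an2-4 gates asym, D1 and NE2/3/4.  HONEST FRAMING (cell contract, verbatim): «discharging `BetaPertH` makes Bałaban's UV stability UNCONDITIONAL —
a real constructive-QFT result; it is NOT the continuum limit and NOT the Clay problem.»  Row D1 ∕ (C1) OWNER an2 (b2b-balaban-beta-an2) gen 72,
2026-08-28.  No existing file touched.
-/

noncomputable section

namespace Summit.QuantumFields.BalabanUV.Beta.FP.NestedConstraintScaling

open Matrix Finset
open scoped BigOperators
open Literature.MathematicalPhysics.QuantumFieldTheory.Balaban1983to89
open Literature.MathematicalPhysics.QuantumFieldTheory.Balaban1983to89.Beta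
open Literature.MathematicalPhysics.QuantumFieldTheory.Balaban1983to89.Beta.Composition (kkt)
open Literature.MathematicalPhysics.QuantumFieldTheory.Balaban1983to89.Beta.HessKerRate (scaleK scaleK_apply hessKer_scaleK)
open Summit.QuantumFields.BalabanUV.Beta.FP.OneShotSocketUnit (kkt_fromRows_smul diagonal_rowUnit_mul_inv)
open B5Prop11Plancherel (fine)
open B6Lemma24Torus (pbox)
open OneStepResolventKernel (Fib)
open ExpKernelCalculus (MKer hessKer)
open Summit.QuantumFields.BalabanUV.Beta.BorderedHessian (stepScale bhK bhKStep bhKStep_zero bhKStep_succ_inr_inl bhKStep_succ_inl_inr)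
open Summit.QuantumFields.BalabanUV.Beta.SymShiftedSpread (bhKStepSh bhKStepSh_apply)
open Summit.QuantumFields.BalabanUV.Beta.FP.KernelPeriodisationFib (Idx perF perF_apply perZ_apply)
open Summit.QuantumFields.BalabanUV.Beta.FP.TorusGaugeCovarianceCoarse (coarsePt)
open Summit.QuantumFields.BalabanUV.Beta.FP.TorusCompositeObjects (towerTorus)
open Summit.QuantumFields.BalabanUV.Beta.FP.TorusCompositeObjectsG (QstepSym QSym compRowsSym compRowsG compRowsG_succ compRowsG_zero)

/-! ## §1 The border of the shifted spread scales with the level -/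

section Border

variable {d : ℕ} {Lc : ℕ} [NeZero Lc]

/-- [folklore] **multiplier–field border**: `𝕄_ℓ (inr κ, inl l) = stepScale ℓ · 𝕄_0 (inr κ, inl l)` for the shifted spread `𝕄_ℓ = bhKStepSh d Lc D ℓ`
(`bhKStep (j+1)`'s border is `stepScale (j+1) ·` that of `bhK Lc = bhKStep 0`; the shift `stepScale ℓ • D` scales the same way; `stepScale 0 = 1`); any shift `D`
(twins at `D := Dsh`, right side `stepScale · (bhK + Dsh)`: `E3ContactFactor.bhKStepSh_mf`, `TorusSymGaugeCovariance.bhKStepSh_Dsh_inr_inl_eq_smul`). -/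
theorem bhKStepSh_inr_inl (D : MKer (d + 1) (Fib d)) (ℓ : ℕ) (x y : Fin (d + 1) → ℤ) (κ l : Fin (d + 1)) :
    bhKStepSh d Lc D ℓ x y (Sum.inr κ) (Sum.inl l) = stepScale d Lc ℓ * bhKStepSh d Lc D 0 x y (Sum.inr κ) (Sum.inl l) := by
  have h0 : stepScale d Lc 0 = 1 := by simp [BorderedHessian.stepScale]
  cases ℓ with
  | zero => rw [h0, one_mul]
  | succ j =>
    simp only [bhKStepSh_apply, Pi.add_apply, Pi.smul_apply, smul_eq_mul, bhKStep_succ_inr_inl, bhKStep_zero, h0]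
    ring

/-- [folklore] **field–multiplier border**: `𝕄_ℓ (inl κ, inr l) = stepScale ℓ · 𝕄_0 (inl κ, inr l)`. -/
theorem bhKStepSh_inl_inr (D : MKer (d + 1) (Fib d)) (ℓ : ℕ) (x y : Fin (d + 1) → ℤ) (κ l : Fin (d + 1)) :
    bhKStepSh d Lc D ℓ x y (Sum.inl κ) (Sum.inr l) = stepScale d Lc ℓ * bhKStepSh d Lc D 0 x y (Sum.inl κ) (Sum.inr l) := by
  have h0 : stepScale d Lc 0 = 1 := by simp [BorderedHessian.stepScale]
  cases ℓ with
  | zero => rw [h0, one_mul]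
  | succ j =>
    simp only [bhKStepSh_apply, Pi.add_apply, Pi.smul_apply, smul_eq_mul, bhKStep_succ_inl_inr, bhKStep_zero, h0]
    ring

end Border

/-! ## §2 The symmetrised one-step rows: the level is a scalar -/

section Rows

variable {d : ℕ} (Lc : ℕ) [NeZero Lc]

/-- [folklore] **`QstepSym Lc M ℓ = stepScale d Lc ℓ • QstepSym Lc M 0`** — the (0.4)-symmetrised one-step rows between `M` and `fine Lc M` read the
(coarse-multiplier, field) border of `perF (fine Lc M) 𝕄_ℓ`, and that border is `stepScale ℓ ·` the level-`0` one (§1; `perZ` is a `tsum`, `tsum_mul_left`). -/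
theorem QstepSym_eq_smul (M : Fin (d + 1) → ℕ) [∀ μ, NeZero (M μ)] (ℓ : ℕ) :
    QstepSym Lc M ℓ = stepScale d Lc ℓ • QstepSym Lc M 0 := by
  ext a b
  simp only [QstepSym, Matrix.submatrix_apply, Matrix.smul_apply, smul_eq_mul, perF_apply, perZ_apply]
  rw [← tsum_mul_left]
  exact tsum_congr fun m => bhKStepSh_inr_inl _ _ _ _ _ _

/-! ## §3 The composite rows: the levels are one product of scalars -/

/-- [folklore] **`compRowsSym Lc M lev rs n = (∏ i ∈ range n, stepScale d Lc (lev (i+1))) • compRowsSym Lc M (fun _ => 0) rs n`** — the `n`-fold composite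
over the symmetrised rows is the UNIT-border composite (every storey at level-`0` scale) times the product of the storeys' `stepScale`s (`compRowsG_succ` is a
matrix product; §2 at each storey; induction on `n`). -/
theorem compRowsSym_eq_prod_smul : ∀ (M : Fin (d + 1) → ℕ) [∀ μ, NeZero (M μ)] (lev : ℕ → ℕ) (rs : ℕ → (Fin (d + 1) → ℕ)) (n : ℕ),
    compRowsSym Lc M lev rs n = (∏ i ∈ range n, stepScale d Lc (lev (i + 1))) • compRowsSym Lc M (fun _ => 0) rs n
  | M, _, lev, rs, 0 => by simp only [compRowsSym, compRowsG_zero, Finset.prod_range_zero, one_smul]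
  | M, _, lev, rs, n + 1 => by
      have ih := compRowsSym_eq_prod_smul (fine Lc M) (fun k => lev (k + 1)) (fun k => rs (k + 1)) n
      have hL : compRowsSym Lc M lev rs (n + 1)
          = QstepSym Lc M (lev 1) * compRowsSym Lc (fine Lc M) (fun k => lev (k + 1)) (fun k => rs (k + 1)) n := compRowsG_succ _ _ _ _ _ _
      have hR : compRowsSym Lc M (fun _ => 0) rs (n + 1)
          = QstepSym Lc M 0 * compRowsSym Lc (fine Lc M) (fun _ => 0) (fun k => rs (k + 1)) n := compRowsG_succ _ _ _ _ _ _
      rw [hL, hR, ih, QstepSym_eq_smul Lc M (lev 1), Matrix.smul_mul, Matrix.mul_smul, smul_smul]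
      congr 1
      rw [Finset.prod_range_succ', Nat.zero_add, mul_comm]

/-! ## §4 The END wrapper's nested coarse constraint `𝔔₀ = Q₂₀ * Q₁₀` is `s_n •` the unit-border composite -/

/-- [folklore] re-indexing: `∏ i ∈ range (n+1), f (n + 1 - (i + 1)) = ∏ i ∈ range (n+1), f i` (`Finset.prod_range_reflect`). -/
theorem prod_range_succ_sub (f : ℕ → ℝ) (n : ℕ) :
    ∏ i ∈ range (n + 1), f (n + 1 - (i + 1)) = ∏ i ∈ range (n + 1), f i := by
  rw [← Finset.prod_range_reflect f (n + 1)]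
  exact Finset.prod_congr rfl fun i _ => by congr 1; omega

omit [NeZero Lc] in
/-- [folklore] **THE WRAPPER's PRODUCT SHAPE**: with the END wrappers' level list `lev i = n + 1 - i` (top storey at level `n+1`, finest at `0`),
`stepScale d Lc (n+1) * ∏ i ∈ range (n+1), stepScale d Lc (n+1-(i+1)) = ∏ ℓ ∈ range (n+1+1), stepScale d Lc ℓ =: s_n`. -/
theorem stepScale_mul_prod_eq (n : ℕ) :
    stepScale d Lc (n + 1) * ∏ i ∈ range (n + 1), stepScale d Lc (n + 1 - (i + 1)) = ∏ ℓ ∈ range (n + 1 + 1), stepScale d Lc ℓ := by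
  rw [prod_range_succ_sub (fun i => stepScale d Lc i) n, Finset.prod_range_succ _ (n + 1), mul_comm]

/-- [folklore] **`𝔔₀ = s_n • 𝔔ᵘ`** — the END wrapper's nested coarse constraint (`h𝔔₀ : Q₂₀ * Q₁₀ = 𝔔₀` with `hQ₂₀ : Q₂₀ = QstepSym Lc M (n+1)` — the wrapper
writes the level as `n + 1 - 0`, definitionally `n + 1` — and `hQ₁₀ : Q₁₀ = compRowsSym Lc (fine Lc M) (fun i => n+1-i) rs (n+1)`) equals
`(∏ ℓ ∈ range (n+1+1), stepScale d Lc ℓ) •` the UNIT-border nested constraint `QstepSym Lc M 0 * compRowsSym Lc (fine Lc M) (fun _ => 0) rs (n+1)`.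
At `d = 3`, `Lc = 3`, `n = 0` the scalar is `stepScale 3 3 0 * stepScale 3 3 1 = 3⁵ = 243`. -/
theorem nestedConstraint_eq_prod_smul (M : Fin (d + 1) → ℕ) [∀ μ, NeZero (M μ)] (rs : ℕ → (Fin (d + 1) → ℕ)) (n : ℕ) :
    QstepSym Lc M (n + 1) * compRowsSym Lc (fine Lc M) (fun i : ℕ => n + 1 - i) rs (n + 1)
      = (∏ ℓ ∈ range (n + 1 + 1), stepScale d Lc ℓ) • (QstepSym Lc M 0 * compRowsSym Lc (fine Lc M) (fun _ => 0) rs (n + 1)) := by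
  rw [QstepSym_eq_smul Lc M (n + 1), compRowsSym_eq_prod_smul Lc (fine Lc M) (fun i : ℕ => n + 1 - i) rs (n + 1), Matrix.smul_mul,
    Matrix.mul_smul, smul_smul, stepScale_mul_prod_eq]

/-- [folklore] the same with the scalar in the wrapper's own product shape `stepScale (n+1) * ∏ i ∈ range (n+1), stepScale (n+1-(i+1))`. -/
theorem nestedConstraint_eq_mul_prod_smul (M : Fin (d + 1) → ℕ) [∀ μ, NeZero (M μ)] (rs : ℕ → (Fin (d + 1) → ℕ)) (n : ℕ) :
    QstepSym Lc M (n + 1) * compRowsSym Lc (fine Lc M) (fun i : ℕ => n + 1 - i) rs (n + 1)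
      = (stepScale d Lc (n + 1) * ∏ i ∈ range (n + 1), stepScale d Lc (n + 1 - (i + 1)))
          • (QstepSym Lc M 0 * compRowsSym Lc (fine Lc M) (fun _ => 0) rs (n + 1)) := by
  rw [stepScale_mul_prod_eq]; exact nestedConstraint_eq_prod_smul Lc M rs n

/-- [folklore] the scalar is positive (hence nonzero): `0 < ∏ ℓ ∈ range m, stepScale d Lc ℓ`. -/
theorem prod_stepScale_pos (m : ℕ) : 0 < ∏ ℓ ∈ range m, stepScale d Lc ℓ :=
  Finset.prod_pos fun ℓ _ => BorderedHessian.stepScale_pos ℓ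

end Rows

/-! ## §5 The KKT constraint-scaling lemma: `FP/OneShotSocketUnit` U6–U8 by name, plus the converse transfer and the block reading -/

section KKT

variable {ν κ ρ : Type*} [Fintype ν] [Fintype κ] [Fintype ρ] [DecidableEq ν] [DecidableEq κ] [DecidableEq ρ]

/-- [folklore] **UNIT ⟶ SCALED** (the converse of `OneShotSocketUnit.kkt_fromRows_mul_rightInverse_of_smul` (U7)): a right inverse `X` of the unit-border system
`kkt H [Q; P]` gives the right inverse `diagonal w′ * X * diagonal w′` of the scaled one `kkt H [c • Q; P]`, `w′ = Sum.elim 1 (Sum.elim c⁻¹ 1)` (`c ≠ 0`; (U6) +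
`diagonal_rowUnit_mul_inv`). -/
theorem kkt_fromRows_smul_mul_conj_eq_one (c : ℝ) (hc : c ≠ 0) (H : Matrix ν ν ℝ) (Q : Matrix κ ν ℝ) (P : Matrix ρ ν ℝ)
    {X : Matrix (ν ⊕ (κ ⊕ ρ)) (ν ⊕ (κ ⊕ ρ)) ℝ} (hX : kkt H (fromRows Q P) * X = 1) :
    kkt H (fromRows (c • Q) P)
        * (diagonal (Sum.elim (fun _ : ν => (1 : ℝ)) (Sum.elim (fun _ : κ => c⁻¹) (fun _ : ρ => (1 : ℝ)))) * X
            * diagonal (Sum.elim (fun _ : ν => (1 : ℝ)) (Sum.elim (fun _ : κ => c⁻¹) (fun _ : ρ => (1 : ℝ))))) = 1 := by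
  have h1 := diagonal_rowUnit_mul_inv (ν := ν) (κ := κ) (ρ := ρ) c hc
  rw [kkt_fromRows_smul c H Q P]
  simp only [Matrix.mul_assoc]
  rw [← Matrix.mul_assoc (diagonal _) (diagonal _) (X * _), h1, Matrix.one_mul, ← Matrix.mul_assoc (kkt H _) X, hX, Matrix.one_mul, h1]

/-- [folklore] **THE BLOCK READING ON THE (field ⊕ coarse) SLOTS** — the submatrix the END's (S3-1) N leg `hLN` displays (cf. (U8) `OneShotSocketUnit.submatrix_leg_rowUnit`,
which keeps the two diagonal factors): for any `X`, `(diagonal w * X * diagonal w)|_(ν ⊕ κ) = fromBlocks X_ff (c • X_fc) (c • X_cf) ((c * c) • X_cc)`,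
`w = Sum.elim 1 (Sum.elim c 1)` — field–field unchanged, field–coarse `× c`, coarse–coarse `× c²`.  With `X := XN`, `c := s_n` (§4) this is `Xᵘ|_(f ⊕ c)`;
read backwards (`c := s_n⁻¹` on `Xᵘ ↔ AN`) it is the σ_n-conjugate display of the leg. -/
theorem submatrix_conj_fieldCoarse (c : ℝ) (X : Matrix (ν ⊕ (κ ⊕ ρ)) (ν ⊕ (κ ⊕ ρ)) ℝ) :
    (diagonal (Sum.elim (fun _ : ν => (1 : ℝ)) (Sum.elim (fun _ : κ => c) (fun _ : ρ => (1 : ℝ)))) * X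
        * diagonal (Sum.elim (fun _ : ν => (1 : ℝ)) (Sum.elim (fun _ : κ => c) (fun _ : ρ => (1 : ℝ))))).submatrix (Sum.map id Sum.inl) (Sum.map id Sum.inl)
      = Matrix.fromBlocks (X.submatrix Sum.inl Sum.inl) (c • X.submatrix Sum.inl (Sum.inr ∘ Sum.inl))
          (c • X.submatrix (Sum.inr ∘ Sum.inl) Sum.inl) ((c * c) • X.submatrix (Sum.inr ∘ Sum.inl) (Sum.inr ∘ Sum.inl)) := by
  ext i j
  rw [Matrix.submatrix_apply, Matrix.mul_diagonal, Matrix.diagonal_mul]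
  rcases i with i | a <;> rcases j with j | b <;> simp [Matrix.fromBlocks, mul_comm, mul_left_comm, mul_assoc]

end KKT

/-! ## §6 The resolvent Hessian kernel: conjugating the chart = conjugating both vertex families -/

section Hess

variable {D : ℕ} {F : Type*} [Fintype F]

omit [Fintype F] in
/-- [folklore] two inverse fibre scalings undo each other on a kernel. -/
theorem scaleK_scaleK_of_inv (u u' : F → ℝ) (h : ∀ a, u a * u' a = 1) (K : MKer D F) : scaleK u' u' (scaleK u u K) = K := by
  funext x y a b
  simp only [scaleK_apply]
  have ha : u' a * u a = 1 := by rw [mul_comm]; exact h a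
  calc u' a * (u a * K x y a b * u b) * u' b = (u' a * u a) * K x y a b * (u b * u' b) := by ring
    _ = K x y a b := by rw [ha, h b, one_mul, mul_one]

/-- [folklore] **`hessKer (σAσ) V W = hessKer A (σVσ) (σWσ)`** for a fibre scaling `σ` with inverse `σ′` (`σ·σ′ = 1`): the units invariance
`HessKerRate.hessKer_scaleK` read from the chart's side.  For the END wrappers: with the σ_n-conjugated one-shot chart in the N leg the law delivers
`hessKer (σ_n AN σ_n) V′ W′` at the N-system's vertex read-outs, and this IS `hessKer AN (σ_n V′ σ_n) (σ_n W′ σ_n)` — the chart `AN` is kept exactly when the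
record's vertex families are the σ_n-conjugates of the read-outs (border entries divided by `s_n`). -/
theorem hessKer_scaleK_chart (σ σ' : F → ℝ) (h : ∀ a, σ a * σ' a = 1) (A : MKer D F) (V : Fin D → (Fin D → ℤ) → MKer D F)
    (W : Fin D → (Fin D → ℤ) → Fin D → (Fin D → ℤ) → MKer D F) :
    hessKer (scaleK σ σ A) V W = hessKer A (fun μ y => scaleK σ σ (V μ y)) (fun μ y ν y' => scaleK σ σ (W μ y ν y')) := by
  have e := hessKer_scaleK σ σ' h A (fun μ y => scaleK σ σ (V μ y)) (fun μ y ν y' => scaleK σ σ (W μ y ν y'))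
  simp only [scaleK_scaleK_of_inv σ σ' h] at e
  exact e

/-- [folklore] the END's instance of the scaling: on the one-shot fibre `Fib d = (field ⊕ multiplier)` the scaling `σ := 1 ⊕ s⁻¹` and its inverse
`σ′ := 1 ⊕ s` (`s ≠ 0`) satisfy `σ · σ′ = 1` slot by slot. -/
theorem fibreScale_mul_inv {d : ℕ} {s : ℝ} (hs : s ≠ 0) (a : Fib d) :
    Sum.elim (fun _ : Fin (d + 1) => (1 : ℝ)) (fun _ : Fin (d + 1) => s⁻¹) a
        * Sum.elim (fun _ : Fin (d + 1) => (1 : ℝ)) (fun _ : Fin (d + 1) => s) a = 1 := by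
  rcases a with a | a <;> simp [hs]

/-- [folklore] **THE END's BOOKKEEPING AT THE σ-LEG**: for the one-shot fibre scaling `σ = 1 ⊕ s⁻¹` (`s ≠ 0`; the row's `s := s_n = ∏_{ℓ<n+2} stepScale`),
`hessKer (σAσ) V W = hessKer A (σVσ) (σWσ)`. -/
theorem hessKer_fibreScale_chart {d : ℕ} {s : ℝ} (hs : s ≠ 0) (A : MKer (d + 1) (Fib d)) (V : Fin (d + 1) → (Fin (d + 1) → ℤ) → MKer (d + 1) (Fib d))
    (W : Fin (d + 1) → (Fin (d + 1) → ℤ) → Fin (d + 1) → (Fin (d + 1) → ℤ) → MKer (d + 1) (Fib d)) :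
    hessKer (scaleK (Sum.elim (fun _ : Fin (d + 1) => (1 : ℝ)) (fun _ : Fin (d + 1) => s⁻¹))
        (Sum.elim (fun _ : Fin (d + 1) => (1 : ℝ)) (fun _ : Fin (d + 1) => s⁻¹)) A) V W
      = hessKer A (fun μ y => scaleK (Sum.elim (fun _ : Fin (d + 1) => (1 : ℝ)) (fun _ : Fin (d + 1) => s⁻¹))
            (Sum.elim (fun _ : Fin (d + 1) => (1 : ℝ)) (fun _ : Fin (d + 1) => s⁻¹)) (V μ y))
          (fun μ y ν y' => scaleK (Sum.elim (fun _ : Fin (d + 1) => (1 : ℝ)) (fun _ : Fin (d + 1) => s⁻¹))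
            (Sum.elim (fun _ : Fin (d + 1) => (1 : ℝ)) (fun _ : Fin (d + 1) => s⁻¹)) (W μ y ν y')) :=
  hessKer_scaleK_chart _ _ (fibreScale_mul_inv hs) A V W

end Hess

end Summit.QuantumFields.BalabanUV.Beta.FP.NestedConstraintScaling

end
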